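import Mathlib
import HarnessLib
import Literature.Geometry.DiscreteGeometry.BondGraph
import Literature.Geometry.DiscreteGeometry.KissingPatterns
import Literature.Geometry.DiscreteGeometry.KissingRigidity
import Summits.AtomisticToContinuum.Crystallization.Theorems.PricedLinkCensusSoftLayerPropagationStubChartAssembly
import Summits.AtomisticToContinuum.Crystallization.Theorems.PricedLinkCensusSoftLayerPropagationStubShadowPatterns
import Summits.AtomisticToContinuum.Crystallization.Theorems.PricedLinkCensusSoftLayerPropagationStubShadowSigns

/-!
# The transition lemma between the charts of two bonded sites (crux `SoftLayerPropagation`, line `Sketch`)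

Route `PricedLinkCensus`, crux `SoftLayerPropagation` (stmt-AtomisticToContinuum-14233), line
`Sketch`, helper file for the stub `stub_shadow` (development of the exact shadow crystal):
registered sub-goal `shadow_transition`, the TRANSITION LEMMA of the development.

Two bonded sites `j ~ k` (with `nn_j > 0`) each carry an exact labelled chart in the sense of
`stub_chartAssembly` — a pattern `P ∈ {FCC, HCP}`, a linear isometry `A` and labels `m` with
`m p` a bond-neighbour within `nn/4` of `y + nn • A p`, `m` injective on `P`, bonds among labelled
sites exactly the pattern contacts, every bond-neighbour labelled.  Then the two labelled BOND
STARS (the bond together with its four common neighbours, read in either chart) are CONGRUENT AS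
LABELLED FIGURES: one linear isometry `L` of `ℝ³` carries the `j`-chart label of every common
neighbour, and of `k`, to its `k`-chart label re-centred at the `k`-chart label of `j`
(`shadow_transition`).  This is what lets a development place the star of `k` rigidly against the
already placed star of `j`.

Proof.  Over the integer models (`shadow_starTables`): the correspondence of labels preserves
contacts (one bond graph) and, by `shadow_starDistances` (the orientation bit of a two-edge star
is pinned by the SIGN of one real inner product, `chart_parallel_clash`), all mutual squared
distances of the star; a contact triangle through the label of `k` is a frame with Gram matrix
`[[4,2,2],[2,4,2],[2,2,4]]` at reference scale `‖·‖ = 2`, so `exists_linearIsometry_of_inner_eq`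
(tree, `KissingRigidity`) produces `L`, and every other label is pinned by its three inner
products with the frame (`eq_zero_of_inner_linearIndependent_fin_three`).  No smallness of `η`
and no charge-freeness enter.  All `[folklore]`.
-/

noncomputable section

namespace Summit.AtomisticToContinuum.Crystallization.Theorems

open Literature.Geometry.DiscreteGeometry
open RealInnerProductSpace

/-! ### The transition lemma over the integer models -/

/-- **Transition lemma, pattern-generic integer form.**  Two bonded sites `j ~ k` of a
configuration `y` carry charts `(S, N, A, m)` at `j` (scale `ν > 0`) and `(S', N', A', m')` at
`k` (scale `ν'`) over integer kissing models: `m` labels the contacts `S` of the model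
bijectively onto the neighbours of `j`, a labelled site sits within `ν/4` of its ideal position
`y j + ν • A (v/√N)`, and two labelled sites are bonded iff their labels are model contacts
(`|v − w|² = N`); the model tables of `…StubShadowPatterns.lean` hold for `(S, N)` and
`(S', N')`.  If `v₀` is the label of `k` at `j` and `v₀'` the label of `j` at `k`, then ONE linear
isometry `L` carries the `j`-chart labels of the bond star to the `k`-chart labels:
`L (v₀/√N) = −v₀'/√N'` and `L (v/√N) = v'/√N' − v₀'/√N'` whenever `m v = m' v'`.
Proof: the four common neighbours are the contacts of `v₀` in `S` and of `v₀'` in `S'`; the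
correspondence preserves contacts (both charts read the same bond graph) and — by the sign lemma
applied to the two parallel contact edges of a type-(δ) star — the orientation bit, hence (tables)
all mutual squared distances; a contact triangle through `v₀` is a frame with Gram matrix
`[[4,2,2],[2,4,2],[2,2,4]]` at reference scale, `exists_linearIsometry_of_inner_eq` gives `L`, and
the remaining labels are pinned by their inner products with the frame. [folklore] -/
theorem transition_of_intCharts {S S' : Finset (Fin 3 → ℤ)} {N N' : ℕ} (hN : N ≠ 0) (hN' : N' ≠ 0)
    (hS : ∀ v ∈ S, sqNormInt v = N) (hS' : ∀ v ∈ S', sqNormInt v = N')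
    (hE : ∀ v₀ ∈ S, ∃ a ∈ S, ∃ b ∈ S,
      sqNormInt (v₀ - a) = N ∧ sqNormInt (v₀ - b) = N ∧ sqNormInt (a - b) = N)
    (hX : ∀ v₀ ∈ S, ∀ q ∈ S, sqNormInt (v₀ - q) = N → ∀ q' ∈ S,
      (sqNormInt (v₀ - q') = N ∧ q ≠ q' ∧ sqNormInt (q - q') ≠ N) →
      (∃ r ∈ S, sqNormInt (v₀ - r) = N ∧ sqNormInt (q - r) = N ∧ sqNormInt (q' - r) = N ∧
          3 * sqNormInt (q - q') = 8 * N) ∨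
      (∃ r₁ ∈ S, ∃ r₂ ∈ S, sqNormInt (v₀ - r₁) = N ∧ sqNormInt (v₀ - r₂) = N ∧
          sqNormInt (q' - r₁) = N ∧ sqNormInt (q - r₁) ≠ N ∧ r₂ ≠ q ∧ r₂ ≠ q' ∧
          sqNormInt (q - r₂) ≠ N ∧ sqNormInt (q' - r₂) ≠ N ∧ sqNormInt (r₁ - r₂) = N ∧
          sqNormInt (q - q') = 2 * N) ∨
      (∃ r₁ ∈ S, ∃ r₂ ∈ S, sqNormInt (v₀ - r₁) = N ∧ sqNormInt (v₀ - r₂) = N ∧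
          sqNormInt (q - r₁) = N ∧ sqNormInt (q' - r₁) ≠ N ∧ r₂ ≠ q' ∧ r₂ ≠ q ∧
          sqNormInt (q' - r₂) ≠ N ∧ sqNormInt (q - r₂) ≠ N ∧ sqNormInt (r₁ - r₂) = N ∧
          sqNormInt (q - q') = 2 * N) ∨
      (∃ r₁ ∈ S, ∃ r₂ ∈ S, sqNormInt (v₀ - r₁) = N ∧ sqNormInt (v₀ - r₂) = N ∧ r₁ ≠ r₂ ∧
          sqNormInt (q' - r₁) = N ∧ sqNormInt (q' - r₂) = N ∧
          sqNormInt (q - r₁) ≠ N ∧ sqNormInt (q - r₂) ≠ N ∧ sqNormInt (q - q') = 3 * N) ∨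
      (∃ r₁ ∈ S, ∃ r₂ ∈ S, sqNormInt (v₀ - r₁) = N ∧ sqNormInt (v₀ - r₂) = N ∧ r₁ ≠ r₂ ∧
          sqNormInt (q - r₁) = N ∧ sqNormInt (q - r₂) = N ∧
          sqNormInt (q' - r₁) ≠ N ∧ sqNormInt (q' - r₂) ≠ N ∧ sqNormInt (q - q') = 3 * N) ∨
      (∃ r₁ ∈ S, ∃ r₂ ∈ S, sqNormInt (v₀ - r₁) = N ∧ sqNormInt (v₀ - r₂) = N ∧ r₁ ≠ r₂ ∧
          sqNormInt (q - r₁) = N ∧ sqNormInt (q' - r₂) = N ∧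
          sqNormInt (r₁ - r₂) ≠ N ∧ sqNormInt (q' - r₁) ≠ N ∧ sqNormInt (q - r₂) ≠ N ∧
          ((q - r₁ = q' - r₂ ∧ sqNormInt (q - q') = 2 * N) ∨
            (q - r₁ = r₂ - q' ∧ sqNormInt (q - q') = 3 * N))))
    (hA' : ∀ v₀ ∈ S', ∀ q ∈ S', sqNormInt (v₀ - q) = N' → ∀ q' ∈ S',
      (sqNormInt (v₀ - q') = N' ∧ q ≠ q' ∧ sqNormInt (q - q') ≠ N') →
      ∀ r ∈ S', (sqNormInt (v₀ - r) = N' ∧ sqNormInt (q - r) = N' ∧ sqNormInt (q' - r) = N') →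
      3 * sqNormInt (q - q') = 8 * N')
    (hB' : ∀ v₀ ∈ S', ∀ q ∈ S', sqNormInt (v₀ - q) = N' → ∀ q' ∈ S',
      (sqNormInt (v₀ - q') = N' ∧ q ≠ q' ∧ sqNormInt (q - q') ≠ N') →
      ∀ r₁ ∈ S', (sqNormInt (v₀ - r₁) = N' ∧ sqNormInt (q' - r₁) = N' ∧ sqNormInt (q - r₁) ≠ N') →
      ∀ r₂ ∈ S', (sqNormInt (v₀ - r₂) = N' ∧ r₂ ≠ q ∧ r₂ ≠ q' ∧ sqNormInt (q - r₂) ≠ N' ∧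
        sqNormInt (q' - r₂) ≠ N' ∧ sqNormInt (r₁ - r₂) = N') →
      sqNormInt (q - q') = 2 * N')
    (hC' : ∀ v₀ ∈ S', ∀ q ∈ S', sqNormInt (v₀ - q) = N' → ∀ q' ∈ S',
      (sqNormInt (v₀ - q') = N' ∧ q ≠ q' ∧ sqNormInt (q - q') ≠ N') →
      ∀ r₁ ∈ S', (sqNormInt (v₀ - r₁) = N' ∧ sqNormInt (q' - r₁) = N' ∧ sqNormInt (q - r₁) ≠ N') →
      ∀ r₂ ∈ S', (sqNormInt (v₀ - r₂) = N' ∧ r₁ ≠ r₂ ∧ sqNormInt (q' - r₂) = N' ∧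
        sqNormInt (q - r₂) ≠ N') →
      sqNormInt (q - q') = 3 * N')
    (hD' : ∀ v₀ ∈ S', ∀ q ∈ S', sqNormInt (v₀ - q) = N' → ∀ q' ∈ S',
      (sqNormInt (v₀ - q') = N' ∧ q ≠ q' ∧ sqNormInt (q - q') ≠ N') →
      ∀ r₁ ∈ S', (sqNormInt (v₀ - r₁) = N' ∧ sqNormInt (q - r₁) = N' ∧ sqNormInt (q' - r₁) ≠ N') →
      ∀ r₂ ∈ S', (sqNormInt (v₀ - r₂) = N' ∧ r₁ ≠ r₂ ∧ sqNormInt (q' - r₂) = N' ∧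
        sqNormInt (r₁ - r₂) ≠ N' ∧ sqNormInt (q - r₂) ≠ N') →
      (q - r₁ = q' - r₂ ∧ sqNormInt (q - q') = 2 * N') ∨
        (q - r₁ = r₂ - q' ∧ sqNormInt (q - q') = 3 * N'))
    -- the configuration and the two charts
    {n : ℕ} {y : Fin n → EuclideanSpace ℝ (Fin 3)} {G : SimpleGraph (Fin n)} {j k : Fin n}
    {ν ν' : ℝ} (hν : 0 < ν)
    {A A' : EuclideanSpace ℝ (Fin 3) →ₗᵢ[ℝ] EuclideanSpace ℝ (Fin 3)} {m m' : (Fin 3 → ℤ) → Fin n}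
    (C2 : ∀ v ∈ S, G.Adj j (m v) ∧
      dist (y (m v)) (y j + ν • A ((Real.sqrt N)⁻¹ • intVec v)) ≤ ν / 4)
    (C3 : ∀ v ∈ S, ∀ w ∈ S, m v = m w → v = w)
    (C4 : ∀ v ∈ S, ∀ w ∈ S, (G.Adj (m v) (m w) ↔ sqNormInt (v - w) = N))
    (C2' : ∀ v ∈ S', G.Adj k (m' v) ∧
      dist (y (m' v)) (y k + ν' • A' ((Real.sqrt N')⁻¹ • intVec v)) ≤ ν' / 4)
    (C3' : ∀ v ∈ S', ∀ w ∈ S', m' v = m' w → v = w)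
    (C4' : ∀ v ∈ S', ∀ w ∈ S', (G.Adj (m' v) (m' w) ↔ sqNormInt (v - w) = N'))
    (C5' : ∀ l, G.Adj k l → ∃ v ∈ S', m' v = l)
    {v₀ : Fin 3 → ℤ} (hv₀ : v₀ ∈ S) (hv₀k : m v₀ = k)
    {v₀' : Fin 3 → ℤ} (hv₀' : v₀' ∈ S') (hv₀'j : m' v₀' = j) :
    ∃ L : EuclideanSpace ℝ (Fin 3) →ₗᵢ[ℝ] EuclideanSpace ℝ (Fin 3),
      L ((Real.sqrt N)⁻¹ • intVec v₀) = -((Real.sqrt N')⁻¹ • intVec v₀') ∧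
      ∀ v ∈ S, ∀ v' ∈ S', m v = m' v' →
        L ((Real.sqrt N)⁻¹ • intVec v) =
          (Real.sqrt N')⁻¹ • intVec v' - (Real.sqrt N')⁻¹ • intVec v₀' := by
  have sqNormInt_sub_comm : ∀ v w : Fin 3 → ℤ, sqNormInt (v - w) = sqNormInt (w - v) :=
    fun v w => by simp only [sqNormInt, Pi.sub_apply]; ring
  /- Step A: transport of labels along the common bond graph. -/
  -- a `k`-chart label of a site is a contact of `v₀'`, its `j`-chart label a contact of `v₀`
  have nbr_of_label : ∀ v ∈ S, ∀ v' ∈ S', m v = m' v' →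
      sqNormInt (v₀ - v) = N ∧ sqNormInt (v₀' - v') = N' := by
    intro v hv v' hv' h
    constructor
    · rw [← C4 v₀ hv₀ v hv, hv₀k, h]; exact (C2' v' hv').1
    · rw [← C4' v₀' hv₀' v' hv', hv₀'j, ← h]; exact (C2 v hv).1
  -- every contact of `v₀` has a `k`-chart label
  have transport : ∀ v ∈ S, sqNormInt (v₀ - v) = N →
      ∃ v' ∈ S', m v = m' v' ∧ sqNormInt (v₀' - v') = N' := by
    intro v hv h
    have hadj : G.Adj k (m v) := by rw [← hv₀k]; exact (C4 v₀ hv₀ v hv).2 h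
    obtain ⟨v', hv', hmv'⟩ := C5' _ hadj
    exact ⟨v', hv', hmv'.symm, (nbr_of_label v hv v' hv' hmv'.symm).2⟩
  -- contacts and (in)equalities of labels are read off the sites
  have adj_transfer : ∀ v ∈ S, ∀ w ∈ S, ∀ v' ∈ S', ∀ w' ∈ S', m v = m' v' → m w = m' w' →
      (sqNormInt (v - w) = N ↔ sqNormInt (v' - w') = N') := by
    intro v hv w hw v' hv' w' hw' h1 h2
    rw [← C4 v hv w hw, ← C4' v' hv' w' hw', h1, h2]
  have eq_transfer : ∀ v ∈ S, ∀ w ∈ S, ∀ v' ∈ S', ∀ w' ∈ S', m v = m' v' → m w = m' w' →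
      v = w → v' = w' := by
    intro v hv w hw v' hv' w' hw' h1 h2 heq
    apply C3' v' hv' w' hw'
    rw [← h1, ← h2, heq]
  /- Step B: squared distances in the star agree (`shadow_starDistances`). -/
  have key : ∀ q ∈ S, ∀ q' ∈ S, ∀ Q ∈ S', ∀ Q' ∈ S', m q = m' Q → m q' = m' Q' →
      q ≠ q' → sqNormInt (q - q') ≠ N →
      sqNormInt (q - q') * N' = sqNormInt (Q - Q') * N :=
    shadow_starDistances S S' N N' hN hN' hX hA' hB' hC' hD' n y G j k ν ν' hν A A' m m'
      C2 C3 C4 C2' C4' C5' v₀ hv₀ hv₀k v₀' hv₀' hv₀'j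
  /- Step C: inner products at reference scale agree. -/
  have inner_transfer : ∀ v ∈ S, ∀ w ∈ S, ∀ v' ∈ S', ∀ w' ∈ S', m v = m' v' → m w = m' w' →
      ⟪refPt N v, refPt N w⟫ = ⟪refPt N' v', refPt N' w'⟫ := by
    intro v hv w hw v' hv' w' hw' h1 h2
    have hNr : (N : ℝ) ≠ 0 := by exact_mod_cast hN
    have hNr' : (N' : ℝ) ≠ 0 := by exact_mod_cast hN'
    have hint : sqNormInt (v - w) * N' = sqNormInt (v' - w') * N := by
      by_cases hvw : v = w
      · have hvw' : v' = w' := eq_transfer v hv w hw v' hv' w' hw' h1 h2 hvw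
        rw [hvw, hvw', sub_self, sub_self]
        simp [sqNormInt]
      · by_cases hadj : sqNormInt (v - w) = N
        · rw [hadj, (adj_transfer v hv w hw v' hv' w' hw' h1 h2).1 hadj, mul_comm]
        · exact key v hv w hw v' hv' w' hw' h1 h2 hvw hadj
    have hreal : (sqNormInt (v - w) : ℝ) / N = (sqNormInt (v' - w') : ℝ) / N' := by
      rw [div_eq_div_iff hNr hNr']
      exact_mod_cast hint
    rw [inner_refPt_eq hN (hS v hv) (hS w hw), inner_refPt_eq hN' (hS' v' hv') (hS' w' hw'),
      mul_div_assoc, hreal, ← mul_div_assoc]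
  /- Step D: the frame and the isometry. -/
  obtain ⟨a, ha, b, hb, ha0, hb0, hab⟩ := hE v₀ hv₀
  obtain ⟨a', ha', hma, ha'0⟩ := transport a ha ha0
  obtain ⟨b', hb', hmb, hb'0⟩ := transport b hb hb0
  have hab' : sqNormInt (a' - b') = N' := (adj_transfer a ha b hb a' ha' b' hb' hma hmb).1 hab
  -- inner products of the frame vectors at reference scale
  have i00 := inner_refPt_self hN (hS v₀ hv₀)
  have iaa := inner_refPt_self hN (hS a ha)
  have ibb := inner_refPt_self hN (hS b hb)
  have i0a : ⟪refPt N v₀, refPt N a⟫ = 2 := inner_refPt_of_contact hN (hS v₀ hv₀) (hS a ha) ha0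
  have i0b : ⟪refPt N v₀, refPt N b⟫ = 2 := inner_refPt_of_contact hN (hS v₀ hv₀) (hS b hb) hb0
  have iab : ⟪refPt N a, refPt N b⟫ = 2 := inner_refPt_of_contact hN (hS a ha) (hS b hb) hab
  have i00' := inner_refPt_self hN' (hS' v₀' hv₀')
  have iaa' := inner_refPt_self hN' (hS' a' ha')
  have ibb' := inner_refPt_self hN' (hS' b' hb')
  have i0a' : ⟪refPt N' v₀', refPt N' a'⟫ = 2 :=
    inner_refPt_of_contact hN' (hS' v₀' hv₀') (hS' a' ha') ha'0
  have i0b' : ⟪refPt N' v₀', refPt N' b'⟫ = 2 :=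
    inner_refPt_of_contact hN' (hS' v₀' hv₀') (hS' b' hb') hb'0
  have iab' : ⟪refPt N' a', refPt N' b'⟫ = 2 := inner_refPt_of_contact hN' (hS' a' ha') (hS' b' hb') hab'
  -- the two frames
  set p : Fin 3 → EuclideanSpace ℝ (Fin 3) := ![refPt N v₀, refPt N a, refPt N b] with hp
  set t : Fin 3 → EuclideanSpace ℝ (Fin 3) :=
    ![-refPt N' v₀', refPt N' a' - refPt N' v₀', refPt N' b' - refPt N' v₀'] with ht
  have hli : LinearIndependent ℝ p := by
    refine linearIndependent_of_gram_triangle ?_ ?_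
    · intro i
      fin_cases i
      · simpa [hp] using i00
      · simpa [hp] using iaa
      · simpa [hp] using ibb
    · intro i l hil
      fin_cases i <;> fin_cases l
      all_goals (first | exact absurd rfl hil | skip)
      · simpa [hp] using i0a
      · simpa [hp] using i0b
      · simpa [hp, real_inner_comm] using i0a
      · simpa [hp] using iab
      · simpa [hp, real_inner_comm] using i0b
      · simpa [hp, real_inner_comm] using iab
  have ia0 : ⟪refPt N a, refPt N v₀⟫ = 2 := by rw [real_inner_comm]; exact i0a
  have ib0 : ⟪refPt N b, refPt N v₀⟫ = 2 := by rw [real_inner_comm]; exact i0b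
  have iba : ⟪refPt N b, refPt N a⟫ = 2 := by rw [real_inner_comm]; exact iab
  have ia0' : ⟪refPt N' a', refPt N' v₀'⟫ = 2 := by rw [real_inner_comm]; exact i0a'
  have ib0' : ⟪refPt N' b', refPt N' v₀'⟫ = 2 := by rw [real_inner_comm]; exact i0b'
  have iba' : ⟪refPt N' b', refPt N' a'⟫ = 2 := by rw [real_inner_comm]; exact iab'
  have hgram : ∀ i l, ⟪p i, p l⟫ = ⟪t i, t l⟫ := by
    intro i l
    fin_cases i <;> fin_cases l <;>
      simp only [hp, ht, Fin.zero_eta, Fin.mk_one, Fin.reduceFinMk, Fin.isValue,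
        Matrix.cons_val_zero, Matrix.cons_val_one, Matrix.cons_val, inner_neg_left,
        inner_neg_right, inner_sub_left, inner_sub_right,
        i00, iaa, ibb, i0a, i0b, iab, ia0, ib0, iba,
        i00', iaa', ibb', i0a', i0b', iab', ia0', ib0', iba'] <;>
      norm_num
  obtain ⟨L, hL⟩ := exists_linearIsometry_of_inner_eq hli hgram
  have hL0 : L (refPt N v₀) = -refPt N' v₀' := by simpa [hp, ht] using hL 0
  have hLa : L (refPt N a) = refPt N' a' - refPt N' v₀' := by simpa [hp, ht] using hL 1
  have hLb : L (refPt N b) = refPt N' b' - refPt N' v₀' := by simpa [hp, ht] using hL 2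
  have hli' : LinearIndependent ℝ (L.toLinearMap ∘ p) :=
    hli.map' L.toLinearMap (LinearMap.ker_eq_bot.2 L.injective)
  -- main claim, at reference scale
  have main : ∀ v ∈ S, ∀ v' ∈ S', m v = m' v' →
      L (refPt N v) = refPt N' v' - refPt N' v₀' := by
    intro v hv v' hv' h
    obtain ⟨hv0, hv'0⟩ := nbr_of_label v hv v' hv' h
    have iv0 : ⟪refPt N v, refPt N v₀⟫ = 2 := by
      refine inner_refPt_of_contact hN (hS v hv) (hS v₀ hv₀) ?_
      rwa [sqNormInt_sub_comm]
    have iv0' : ⟪refPt N' v', refPt N' v₀'⟫ = 2 := by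
      refine inner_refPt_of_contact hN' (hS' v' hv') (hS' v₀' hv₀') ?_
      rwa [sqNormInt_sub_comm]
    have iva := inner_transfer v hv a ha v' hv' a' ha' h hma
    have ivb := inner_transfer v hv b hb v' hv' b' hb' h hmb
    rw [← sub_eq_zero]
    refine eq_zero_of_inner_linearIndependent_fin_three hli' fun i => ?_
    rw [Function.comp_apply, LinearIsometry.coe_toLinearMap, inner_sub_left,
      LinearIsometry.inner_map_map]
    fin_cases i
    · simp only [hp, Fin.zero_eta, Fin.isValue, Matrix.cons_val_zero, hL0, inner_neg_right,
        inner_sub_left, iv0, iv0', i00']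
      norm_num
    · simp only [hp, Fin.mk_one, Fin.isValue, Matrix.cons_val_one, Matrix.cons_val_zero, hLa,
        inner_sub_left, inner_sub_right, iva, iv0', i0a', i00']
      norm_num
    · simp only [hp, Fin.reduceFinMk, Matrix.cons_val, hLb,
        inner_sub_left, inner_sub_right, ivb, iv0', i0b', i00']
      norm_num
  -- back to unit scale
  have two : (2 : ℝ) ≠ 0 := two_ne_zero
  refine ⟨L, ?_, ?_⟩
  · have h := hL0
    rw [refPt_eq_two_smul, refPt_eq_two_smul, L.map_smul, ← smul_neg] at h
    exact smul_right_injective (EuclideanSpace ℝ (Fin 3)) two h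
  · intro v hv v' hv' h
    have h' := main v hv v' hv' h
    rw [refPt_eq_two_smul, refPt_eq_two_smul, refPt_eq_two_smul, L.map_smul, ← smul_sub] at h'
    exact smul_right_injective (EuclideanSpace ℝ (Fin 3)) two h'
/-! ### The transition lemma in the vocabulary of the line -/

/-- **Registered sub-goal `shadow_transition`** of the crux item (TRANSITION LEMMA of the
development of the shadow crystal).  Let `j ~ k` be bonded sites of a configuration `y` with
`nn_j > 0`, each carrying an exact labelled chart in the sense of `stub_chartAssembly`: a pattern
`P ∈ {FCC, HCP}`, a linear isometry `A` and labels `m` with `m p` a bond-neighbour of the site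
within `nn/4` of its ideal position, `m` injective on `P`, bonds among labelled sites exactly the
pattern contacts, every bond-neighbour labelled.  Then the two charts induce CONGRUENT LABELLED
BOND STARS: one linear isometry `L` with `L p = −p'` for the labels `p` of `k` at `j` and `p'` of
`j` at `k`, and `L q = q' − p'` whenever `q ∈ P` and `q' ∈ P'` label the same (common) neighbour.
In particular the `√2`/`√3` pairing of the four common neighbours agrees in the two charts —
decided not by distances (the window `nn/4` is too coarse) but by the ORIENTATION of the two
parallel contact edges of the star, which each chart pins through the sign of one inner product
(`chart_parallel_clash`).  No smallness of `η` and no charge-freeness is needed. [folklore] -/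
theorem shadow_transition :  ∀ (η : ℝ) (N : ℕ) (y : Fin N → EuclideanSpace ℝ (Fin 3)) (j k : Fin N),
    0 < Literature.Geometry.DiscreteGeometry.nearestDist y j →
    (Literature.Geometry.DiscreteGeometry.bondGraph η y).Adj j k → ∀ (P : Finset (EuclideanSpace ℝ
    (Fin 3))) (A : EuclideanSpace ℝ (Fin 3) →ₗᵢ[ℝ] EuclideanSpace ℝ (Fin 3)) (m : EuclideanSpace ℝ
    (Fin 3) → Fin N), (P = Literature.Geometry.DiscreteGeometry.fccKissingPattern ∨ P =
    Literature.Geometry.DiscreteGeometry.hcpKissingPattern) → (∀ p ∈ P,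
    (Literature.Geometry.DiscreteGeometry.bondGraph η y).Adj j (m p) ∧ dist (y (m p)) (y j +
    Literature.Geometry.DiscreteGeometry.nearestDist y j • A p) ≤
    Literature.Geometry.DiscreteGeometry.nearestDist y j / 4) → (∀ p ∈ P, ∀ q ∈ P, m p = m q → p =
    q) → (∀ p ∈ P, ∀ q ∈ P, ((Literature.Geometry.DiscreteGeometry.bondGraph η y).Adj (m p) (m q) ↔
    dist p q = 1)) → (∀ l, (Literature.Geometry.DiscreteGeometry.bondGraph η y).Adj j l → ∃ p ∈ P, m
    p = l) → ∀ (P' : Finset (EuclideanSpace ℝ (Fin 3))) (A' : EuclideanSpace ℝ (Fin 3) →ₗᵢ[ℝ]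
    EuclideanSpace ℝ (Fin 3)) (m' : EuclideanSpace ℝ (Fin 3) → Fin N), (P' =
    Literature.Geometry.DiscreteGeometry.fccKissingPattern ∨ P' =
    Literature.Geometry.DiscreteGeometry.hcpKissingPattern) → (∀ p ∈ P',
    (Literature.Geometry.DiscreteGeometry.bondGraph η y).Adj k (m' p) ∧ dist (y (m' p)) (y k +
    Literature.Geometry.DiscreteGeometry.nearestDist y k • A' p) ≤
    Literature.Geometry.DiscreteGeometry.nearestDist y k / 4) → (∀ p ∈ P', ∀ q ∈ P', m' p = m' q → p
    = q) → (∀ p ∈ P', ∀ q ∈ P', ((Literature.Geometry.DiscreteGeometry.bondGraph η y).Adj (m' p) (m'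
    q) ↔ dist p q = 1)) → (∀ l, (Literature.Geometry.DiscreteGeometry.bondGraph η y).Adj k l → ∃ p ∈
    P', m' p = l) → ∃ L : EuclideanSpace ℝ (Fin 3) →ₗᵢ[ℝ] EuclideanSpace ℝ (Fin 3), ∀ p ∈ P, ∀ p' ∈
    P', m p = k → m' p' = j → L p = -p' ∧ ∀ q ∈ P, ∀ q' ∈ P', m q = m' q' → L q = q' - p' := by
  intro η n y j k hν hjk P A m hP C2 C3 C4 C5 P' A' m' hP' C2' C3' C4' C5'
  -- the integer models behind the two patterns
  obtain ⟨S, N, hN, hS, rfl, hE, hX, -, -, -, -⟩ := shadow_starTables P hP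
  obtain ⟨S', N', hN', hS', rfl, -, -, hA', hB', hC', hD'⟩ := shadow_starTables P' hP'
  have memS : ∀ v ∈ S, ((Real.sqrt N)⁻¹ • intVec v : EuclideanSpace ℝ (Fin 3)) ∈
      scaledPattern S N := fun v hv => Finset.mem_image_of_mem _ hv
  have memS' : ∀ v ∈ S', ((Real.sqrt N')⁻¹ • intVec v : EuclideanSpace ℝ (Fin 3)) ∈
      scaledPattern S' N' := fun v hv => Finset.mem_image_of_mem _ hv
  have ofMem : ∀ p ∈ scaledPattern S N, ∃ v ∈ S, ((Real.sqrt N)⁻¹ • intVec v) = p :=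
    fun p hp => Finset.mem_image.1 hp
  have ofMem' : ∀ p ∈ scaledPattern S' N', ∃ v ∈ S', ((Real.sqrt N')⁻¹ • intVec v) = p :=
    fun p hp => Finset.mem_image.1 hp
  -- the two charts over the integer models
  have Z2 : ∀ v ∈ S, (bondGraph η y).Adj j (m ((Real.sqrt N)⁻¹ • intVec v)) ∧
      dist (y (m ((Real.sqrt N)⁻¹ • intVec v)))
        (y j + nearestDist y j • A ((Real.sqrt N)⁻¹ • intVec v)) ≤ nearestDist y j / 4 :=
    fun v hv => C2 _ (memS v hv)
  have Z3 : ∀ v ∈ S, ∀ w ∈ S,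
      m ((Real.sqrt N)⁻¹ • intVec v) = m ((Real.sqrt N)⁻¹ • intVec w) → v = w :=
    fun v hv w hw h => scaledPattern_map_injective hN (C3 _ (memS v hv) _ (memS w hw) h)
  have Z4 : ∀ v ∈ S, ∀ w ∈ S,
      ((bondGraph η y).Adj (m ((Real.sqrt N)⁻¹ • intVec v)) (m ((Real.sqrt N)⁻¹ • intVec w)) ↔
        sqNormInt (v - w) = N) := fun v hv w hw => by
    rw [C4 _ (memS v hv) _ (memS w hw), dist_scaled_intVec_eq_one_iff hN]
  have Z2' : ∀ v ∈ S', (bondGraph η y).Adj k (m' ((Real.sqrt N')⁻¹ • intVec v)) ∧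
      dist (y (m' ((Real.sqrt N')⁻¹ • intVec v)))
        (y k + nearestDist y k • A' ((Real.sqrt N')⁻¹ • intVec v)) ≤ nearestDist y k / 4 :=
    fun v hv => C2' _ (memS' v hv)
  have Z3' : ∀ v ∈ S', ∀ w ∈ S',
      m' ((Real.sqrt N')⁻¹ • intVec v) = m' ((Real.sqrt N')⁻¹ • intVec w) → v = w :=
    fun v hv w hw h => scaledPattern_map_injective hN' (C3' _ (memS' v hv) _ (memS' w hw) h)
  have Z4' : ∀ v ∈ S', ∀ w ∈ S',
      ((bondGraph η y).Adj (m' ((Real.sqrt N')⁻¹ • intVec v)) (m' ((Real.sqrt N')⁻¹ • intVec w)) ↔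
        sqNormInt (v - w) = N') := fun v hv w hw => by
    rw [C4' _ (memS' v hv) _ (memS' w hw), dist_scaled_intVec_eq_one_iff hN']
  have Z5' : ∀ l, (bondGraph η y).Adj k l → ∃ v ∈ S', m' ((Real.sqrt N')⁻¹ • intVec v) = l := by
    intro l hl
    obtain ⟨p, hp, rfl⟩ := C5' l hl
    obtain ⟨v, hv, rfl⟩ := ofMem' p hp
    exact ⟨v, hv, rfl⟩
  -- the labels of the bond
  obtain ⟨p₀, hp₀, hp₀k⟩ := C5 k hjk
  obtain ⟨v₀, hv₀, rfl⟩ := ofMem p₀ hp₀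
  obtain ⟨p₀', hp₀', hp₀'j⟩ := C5' j hjk.symm
  obtain ⟨v₀', hv₀', rfl⟩ := ofMem' p₀' hp₀'
  obtain ⟨L, hL0, hL⟩ := transition_of_intCharts hN hN' hS hS' hE hX hA' hB' hC' hD' hν
    (m := fun v => m ((Real.sqrt N)⁻¹ • intVec v)) (m' := fun v => m' ((Real.sqrt N')⁻¹ • intVec v))
    Z2 Z3 Z4 Z2' Z3' Z4' Z5' hv₀ hp₀k hv₀' hp₀'j
  refine ⟨L, fun p hp p' hp' hpk hp'j => ?_⟩
  obtain ⟨v, hv, rfl⟩ := ofMem p hp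
  obtain ⟨v', hv', rfl⟩ := ofMem' p' hp'
  obtain rfl : v = v₀ := Z3 v hv v₀ hv₀ (hpk.trans hp₀k.symm)
  obtain rfl : v' = v₀' := Z3' v' hv' v₀' hv₀' (hp'j.trans hp₀'j.symm)
  refine ⟨hL0, fun q hq q' hq' hqq' => ?_⟩
  obtain ⟨w, hw, rfl⟩ := ofMem q hq
  obtain ⟨w', hw', rfl⟩ := ofMem' q' hq'
  exact hL w hw w' hw' hqq'

end Summit.AtomisticToContinuum.Crystallization.Theorems

end
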